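import Summits.BirchSwinnertonDyer.Rank1Residual.X5.TwoAdicTargetsTowerGapEnd
import Summits.BirchSwinnertonDyer.Rank1Residual.X5.TwoAdicTargetsAlpha
import HarnessLib

/-!
# Class O1 (X5, `p = 2`, non-CM), seat `bsd-2adic-ord` (Kato at ordinary `2`): the RESIDUAL of
# Kato's divisibility at a good ordinary `2` is its `𝔭 = (2)` clause — `O1.KatoMuPartAtTwo`, TYPED —
# and the item `MainConjectureLowerDivisibilityAtTwoOrd` is EQUIVALENT to it modulo print

HONEST FRAMING (cell `bsd-2adic`, run/shared/lean/pub/bsd-2adic/, HUMAN RULING D-0036): ONE displayed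
hypothesis (`def … : Prop`, Summits-side, a construction TARGET; NOTHING asserted, no Literature
fact, no `@[conjecture]`) + PROVED bookkeeping. Every deep input is a hypothesis that is a PUBLISHED
named fact of the tree (`kato_divisibility_allPrimes W 2` = Kato 2004 Thm. 17.4 (1)(2) at `p = 2`;
`prop514_isTorsion_mu_eq_zero_two` = Greenberg LNM 1716 Prop. 5.14) or a per-curve certificate
(`hint`: the Néron-normalised `2`-adic `L`-function is integral, `ϖ·L₂(f,α) = ι L₀`). Nothing is
booked; O1 stays OPEN; no count of record moves.

## The seat's reading of Kato at `p = 2` (Astérisque 295, first-hand)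

Thm. 12.5 (3) (p. 222): `length_{Λ_𝔭} H²(V)_𝔭 ≤ length_{Λ_𝔭}(H¹(V)_𝔭/Z(f)_𝔭) (+ H²_loc)` for EVERY
height-one `𝔭 ∌ p` — NO parity and NO image hypothesis. Thm. 12.5 (4) (all `𝔭`, integral):
"Assume `p ≠ 2`" AND (12.5.2) (`SL₂(ℤ_p) ⊆` image). The parity restriction enters ONLY through
Thm. 13.4 (3) (p. 226, the Euler-system bound at `𝔭 = (p)`, quoted from [Pe4, Ru4, KK4]: "Assume
further `p ≠ 2`"). Conj. 12.10 (p. 224) itself reads "In the case `p = 2`, assume `𝔭` does not contain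
2". Thm. 17.4 (p. 273) transports 12.5 to `X(E/ℚ_∞)` and `L₂(E)`: clauses (1)(2) = the tree's
`kato_divisibility_allPrimes W 2` (`X` torsion, `char_Λ X ∣ 2ⁿ·L₂` for SOME `n`), clause (3) prints
`p ≠ 2`. CONSEQUENCE: at a good ordinary `2` the only clause of Kato's divisibility that is not a
theorem in print is the one at `𝔭 = (2)`, i.e. the `μ`-inequality `μ(X(E/ℚ_∞)) ≤ μ(ϖ·L₂(E))`;
equivalently (UFD `Λ`, `μ` additive) `2^{μ(X)} ∣ ϖ·L₂(E)` in `Λ`. The 'explicit finite error term'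
of the seat's brief — the least `n` with `char_Λ X ∣ 2ⁿ·ϖ·L₂` — is `n = max(0, μ(X) − μ(ϖ·L₂))`
(refuter's `MuZeroUpgrade.C_pow_mul_mem_charIdeal_iff_mu_le` at `μ(L₀) = 0`; `dvd_C_pow_mul_iff_mu_le`).

## Contents

* `O1.KatoMuPartAtTwo W` — **K4ᵒ-μ, the typed residual**: for the cyclotomic `ℤ₂`-extension, IF `E`
  is good ordinary at `2`, for the newform `f`, the Néron ratio `ϖ` (`ϖ·Ω_E = Ω⁺_f`), every dual
  datum `D` and every `L₀ ∈ Λ` with `ι L₀ = ϖ·L₂(f,α)`: `2^{μ(X)} ∣ L₀` in `Λ`. A construction TARGET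
  (the `𝔭 = (2)` clause of Kato's Thm. 12.5 (4) / Conj. 12.10 on the Selmer side); NOT in print for
  any non-CM curve class; nothing asserted.
* `mainConjectureLowerDivisibilityAtTwoOrd_iff_katoMuPartAtTwo` (PROVED): modulo Kato 17.4 (1)(2)@2
  (`h17`) and the Néron-integrality certificate (`hint`), the lane's typed item
  `O1.MainConjectureLowerDivisibilityAtTwoOrd W` (Kato direction, Néron-normalised, integral — see
  `X5/TwoAdicTargetsAlpha.lean` ORIENTATION) is EQUIVALENT to `O1.KatoMuPartAtTwo W`. So the item is
  EXACTLY the `μ`-part; everything else in it is Kato's printed theorem.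
* `katoMuPartAtTwo_of_mu_eq_zero`, `katoMuPartAtTwo_of_towerGapAtTwo`, `katoMuPartAtTwo_of_prop514`
  (PROVED): the residual is discharged wherever `μ₂(X(E/ℚ_∞)) = 0` is known — the tower-gap
  certificate (T10) or Greenberg Prop. 5.14 AT `2` (PRINT; the α-go habitat, 83 / 611 good-ordinary
  O1 residue classes of record).
* What this is NOT: not a proof of `KatoMuPartAtTwo` off the `μ = 0` locus (there it is the `μ`-part
  of the `2`-adic main conjecture: on Greenberg's Prop. 5.13 locus `μ(X) ≥ 1` is PRINTED and the
  item demands `2 ∣ ϖ·L₂(E)` in `Λ` — seat STEP-0 jobs j239548/j239586: `μ(ϖ·L₂) ≥ 1` on 28/28 such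
  curves, `= 0` on 22/22 Prop-5.14 curves, and `μ(ϖ·L₂(E_i)) = μ_{E_i} = 1,2,0,2,3,3,0,0` on the
  eight curves of conductor 15, reproducing Greenberg's printed table (LNM 1716 p. 122) on the
  analytic side — EVIDENCE, not used here); not the Eisenstein (lower) half; not `BSD(E,2)`.

References: K. Kato, Astérisque 295 (2004), Thm. 12.5 (pp. 221–222), Conj. 12.10 (p. 224), Thm. 13.4
(p. 226), Thm. 17.4 (p. 273); R. Greenberg, LNM 1716 (1999), Props. 5.13–5.14 and the Remark between
them (`μ_E = m_E` conjecturally), conductor-15 table; R. Greenberg, V. Vatsal, Invent. Math. 142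
(2000), p. 4; K. Matsuno, IJNT 4 (2008), Prop. 6.2, Remark (17A2), Prop. 6.5, Example 2 (N = 1169).
-/

set_option autoImplicit false

noncomputable section

open scoped Classical MatrixGroups ModularForm

open CongruenceSubgroup WeierstrassCurve Literature.NumberTheory.EllipticCurves
  Literature.NumberTheory.EllipticCurves.ModularForms
  Literature.NumberTheory.EllipticCurves.Rank1Residual
  Literature.NumberTheory.EllipticCurves.Rank1Residual.Typed
  Literature.NumberTheory.EllipticCurves.Greenberg1999
  Summit.BirchSwinnertonDyer.Rank1Residual.X1.MuLambda
  Summit.BirchSwinnertonDyer.Rank1Residual.X1.MuPart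

namespace Summit.BirchSwinnertonDyer.Rank1Residual.X5.O1

variable (W : WeierstrassCurve ℚ) [W.IsElliptic] [W.IsGloballyMinimal]

/-- **K4ᵒ-μ — the `μ`-part of Kato's divisibility at a good ordinary `2`, TYPED (construction
target; nothing asserted).** For the cyclotomic `ℤ₂`-extension (`κ`, topological generator `γ`
matching the cyclotomic variable), IF `E` (globally minimal `W`) is good ordinary at `2`: for the
newform `f` of level `N_E`, the rational `ϖ` with `ϖ·Ω_E = Ω⁺_f`, every Pontryagin-dual datum `D`
(`X = X(E/ℚ_∞)`, `μ(X) = D.mu`) and every `L₀ ∈ Λ = ℤ₂⟦T⟧` with `ι L₀ = ϖ·L₂(f, α)`: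
`2^{μ(X)} ∣ L₀` in `Λ` — i.e. `μ(X(E/ℚ_∞)) ≤ μ(ϖ·L₂(E))`, the `𝔭 = (2)` clause that Kato's
Thm. 12.5 (4) / 17.4 (3) prove only for `p ≠ 2` under (12.5.2) and that Conj. 12.10 excludes at
`p = 2`. Vacuous off the good-ordinary cell (guard `IsOrdinaryAt W 2`) and wherever no integral `L₀`
exists. NOT in print for any class of non-CM curves; discharged on the `μ = 0` locus
(`katoMuPartAtTwo_of_mu_eq_zero`). An `@[conjecture]` OBLIGATION of ours in the sense of
`X5/TwoAdicTargets.lean` (ii) — OPEN; nothing asserted. [cite: Kato2004Asterisque, Thm. 12.5 (4) (p. 222), Conj. 12.10 (p. 224), Thm. 17.4 (3) (p. 273) (shape of the missing clause; nothing asserted)] -/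
@[conjecture] def KatoMuPartAtTwo : Prop :=
  ∀ (κ : ZpExtension ℚ 2) (γ : Field.absoluteGaloisGroup ℚ),
      κ.IsCyclotomic → κ.IsTopGenerator γ → IsCyclotomicVariable 2 γ → IsOrdinaryAt W 2 →
    ∀ [NeZero (W.conductorNorm ℤ)] (f : CuspForm (Gamma0 (W.conductorNorm ℤ)) 2),
      IsNewformOf W f → ∀ (ϖ : ℚ), (ϖ : ℝ) * W.realPeriodRat = plusPeriod f →
    ∀ (D : W.SelmerDualData κ γ) (L₀ : IwasawaAlgebra 2),
      iwasawaToPowerSeries 2 L₀ =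
          PowerSeries.C (ϖ : ℚ_[2]) * padicLFunction f (unitRoot W 2 : ℚ_[2]) →
      (PowerSeries.C (((2 : ℕ) : ℤ_[2]) ^ D.mu) : IwasawaAlgebra 2) ∣ L₀

omit [W.IsElliptic] in
/-- **The residual vanishes on the `μ = 0` locus**: if every cyclotomic dual datum has `μ = 0`, then
`KatoMuPartAtTwo W` holds (`2^0 = 1 ∣ L₀`). [folklore] -/
theorem katoMuPartAtTwo_of_mu_eq_zero
    (hμ : ∀ (κ : ZpExtension ℚ 2) (γ : Field.absoluteGaloisGroup ℚ), κ.IsCyclotomic →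
      κ.IsTopGenerator γ → IsCyclotomicVariable 2 γ → ∀ D : W.SelmerDualData κ γ, D.mu = 0) :
    KatoMuPartAtTwo W := by
  intro κ γ hκ hγ hγ' _ _ f _ ϖ _ D L₀ _
  rw [hμ κ γ hκ hγ hγ' D, pow_zero, map_one]
  exact one_dvd _

/-- The tower-gap certificate (`μ₂ = 0`, T10) discharges the residual. [cite: Washington1997, §13.2] -/
theorem katoMuPartAtTwo_of_towerGapAtTwo (hgap : TowerGapAtTwo W) : KatoMuPartAtTwo W :=
  katoMuPartAtTwo_of_mu_eq_zero W fun _ _ hκ hγ hγ' D =>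
    (isTorsion_and_mu_eq_zero_of_towerGapAtTwo W hgap hκ hγ hγ' D).2

/-- **Greenberg Prop. 5.14 AT `2` (PRINT, named fact `h514`) discharges the residual on the α-go
habitat**: good ordinary `2` and a rational point of order `2` that is ramified-at-`2` XOR odd.
[cite: GreenbergLNM1716, Prop. 5.14 (p. 121; held copy chunk p0170)] -/
theorem katoMuPartAtTwo_of_prop514 (h514 : prop514_isTorsion_mu_eq_zero_two) (hgo : GoodOrd W 2)
    {x y : ℚ} (hP : W.toAffine.Equation x y) (h2 : 2 * y + W.a₁ * x + W.a₃ = 0)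
    (hΦ : (TwoTorsionRamifiedAtTwo x ∧ ¬ TwoTorsionOdd W x) ∨
      (TwoTorsionOdd W x ∧ ¬ TwoTorsionRamifiedAtTwo x)) :
    KatoMuPartAtTwo W :=
  katoMuPartAtTwo_of_mu_eq_zero W fun _ _ hκ hγ _ D =>
    (isTorsion_and_mu_eq_zero_of_prop514 W h514 hgo hP h2 hΦ hκ hγ D).2

/-- **Item ⇒ residual (modulo Kato 17.4 (1) at `2` for `X` torsion).** If
`MainConjectureLowerDivisibilityAtTwoOrd W` holds then so does `KatoMuPartAtTwo W`: the item's `g`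
equals `L₀` (`ι` injective), `g ∈ char_Λ X = (f_E)`, and `2^{μ(f_E)} ∣ f_E` with `μ(f_E) = μ(X)`
(`mu_generator_eq_muInvariant`, which needs `X` torsion — Kato 17.4 (1)@2, `h17`).
[cite: Kato2004Asterisque, Thm. 17.4 (1) (p. 273)] -/
theorem katoMuPartAtTwo_of_mainConjectureLowerDivisibilityAtTwoOrd
    (h17 : ∀ [NeZero (W.conductorNorm ℤ)] (f : CuspForm (Gamma0 (W.conductorNorm ℤ)) 2),
      kato_divisibility_allPrimes W 2 (f := f))
    (h : MainConjectureLowerDivisibilityAtTwoOrd W) : KatoMuPartAtTwo W := by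
  intro κ γ hκ hγ hγ' hord _ f hf ϖ hϖ D L₀ hL₀
  haveI : Module.Finite (IwasawaAlgebra 2) D.X := D.module_finite_holds hγ
  obtain ⟨g, hg, hιg⟩ := h κ γ hκ hγ hγ' hord f hf ϖ hϖ D
  have hgL : g = L₀ := iwasawaToPowerSeries_injective 2 (hιg.trans hL₀.symm)
  subst hgL
  by_cases hg0 : g = 0
  · rw [hg0]; exact dvd_zero _
  obtain ⟨fE, hfE⟩ := (charIdeal_isPrincipal_holds 2 D.X).principal
  have hchar : D.charIdeal = Ideal.span {fE} := hfE
  rw [hchar] at hg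
  obtain ⟨c, hc⟩ := Ideal.mem_span_singleton'.mp hg
  have hfE0 : fE ≠ 0 := by
    rintro rfl
    exact hg0 (by rw [← hc, mul_zero])
  have hD : D.IsTorsion := (h17 f κ γ hκ hγ hγ' hord hf D).1
  have hμ : mu fE = D.mu := mu_generator_eq_muInvariant D.X hD hfE0 hchar
  rw [← hμ]
  exact (C_pow_mu_dvd hfE0).trans (Dvd.intro_left c hc)

/-- **Residual ⇒ item (modulo Kato 17.4 (1)(2) at `2` and the Néron-integrality certificate).**
Kato's `char_Λ X ∣ 2ⁿ·ϖ·L₂` pulled back to `Λ` (`exists_mul_charGen_eq_of_kato_allPrimes`: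
`(num ϖ · a)·f_E = 2ⁿ·(den ϖ · L₀)`), the residual `2^{μ(X)} ∣ L₀` (so `μ(f_E) = μ(X) ≤ μ(L₀)`), the
master cancellation `mem_span_of_mul_eq_C_pow_mul_of_mu_le` and denominator stripping give
`L₀ ∈ (f_E) = char_Λ X`, i.e. the item's `∃ g ∈ char_Λ X, ι g = ϖ·L₂(f,α)` with `g = L₀`.
[cite: Kato2004Asterisque, Thm. 17.4 (1)(2) (p. 273)] [cite: GreenbergVatsal2000, p. 4 (after Thm. (1.2))] -/
theorem mainConjectureLowerDivisibilityAtTwoOrd_of_katoMuPartAtTwo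
    (h17 : ∀ [NeZero (W.conductorNorm ℤ)] (f : CuspForm (Gamma0 (W.conductorNorm ℤ)) 2),
      kato_divisibility_allPrimes W 2 (f := f))
    (hint : ∀ [NeZero (W.conductorNorm ℤ)] (f : CuspForm (Gamma0 (W.conductorNorm ℤ)) 2),
      IsNewformOf W f → ∀ ϖ : ℚ, (ϖ : ℝ) * W.realPeriodRat = plusPeriod f →
        ∃ L₀ : IwasawaAlgebra 2, iwasawaToPowerSeries 2 L₀ =
          PowerSeries.C (ϖ : ℚ_[2]) * padicLFunction f (unitRoot W 2 : ℚ_[2]))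
    (hμ : KatoMuPartAtTwo W) : MainConjectureLowerDivisibilityAtTwoOrd W := by
  intro κ γ hκ hγ hγ' hord _ f hf ϖ hϖ D
  haveI : Module.Finite (IwasawaAlgebra 2) D.X := D.module_finite_holds hγ
  obtain ⟨L₀, hL₀⟩ := hint f hf ϖ hϖ
  refine ⟨L₀, ?_, hL₀⟩
  have hdvd := hμ κ γ hκ hγ hγ' hord f hf ϖ hϖ D L₀ hL₀
  by_cases hL₀0 : L₀ = 0
  · rw [hL₀0]; exact zero_mem _
  obtain ⟨fE, hfE⟩ := (charIdeal_isPrincipal_holds 2 D.X).principal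
  have hchar : D.charIdeal = Ideal.span {fE} := hfE
  obtain ⟨hD, a, n, hkey⟩ :=
    MuZeroUpgrade.exists_mul_charGen_eq_of_kato_allPrimes W 2 (h17 f) hκ hγ hγ' hord hf D hchar hL₀
  have hden0 : (PowerSeries.C (ϖ.den : ℤ_[2]) : IwasawaAlgebra 2) ≠ 0 := fun h0 =>
    ϖ.den_nz (by exact_mod_cast (PowerSeries.C_injective (h0.trans (map_zero _).symm) :
      ((ϖ.den : ℕ) : ℤ_[2]) = 0))
  have hdL0 : PowerSeries.C (ϖ.den : ℤ_[2]) * L₀ ≠ 0 := mul_ne_zero hden0 hL₀0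
  have hfE0 : fE ≠ 0 := by
    rintro rfl
    rw [mul_zero] at hkey
    exact mul_ne_zero (C_pow_ne_zero n) hdL0 hkey.symm
  have hμfE : mu fE = D.mu := mu_generator_eq_muInvariant D.X hD hfE0 hchar
  have hle : mu fE ≤ mu L₀ := by
    rw [hμfE]; exact le_mu_of_C_pow_dvd hL₀0 hdvd
  have hle' : mu fE ≤ mu (PowerSeries.C (ϖ.den : ℤ_[2]) * L₀) := by
    rw [mul_comm]; exact hle.trans (mu_le_mu_mul hL₀0 hden0)
  have h1 : PowerSeries.C (ϖ.den : ℤ_[2]) * L₀ ∈ Ideal.span {fE} :=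
    MuZeroUpgrade.mem_span_of_mul_eq_C_pow_mul_of_mu_le hfE0 hkey hle'
  rw [hchar]
  exact MuZeroUpgrade.mem_span_of_C_natCast_mul_mem_span hfE0 ϖ.den_nz hle h1

/-- **THE TYPED ITEM IS EXACTLY THE `μ`-PART.** Modulo Kato 17.4 (1)(2) at `2` (`h17`, PRINT) and
the Néron-integrality certificate (`hint`): `MainConjectureLowerDivisibilityAtTwoOrd W ⟺
KatoMuPartAtTwo W`. Reading: the lane's E2 residue item at a good ordinary `2` in Kato's direction
asks for nothing beyond print EXCEPT `μ(X(E/ℚ_∞)) ≤ μ(ϖ·L₂(E))`; with `μ(X) = 0` known (tower-gap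
certificate, Prop. 5.14) it is discharged; with `μ(X) ≥ 1` (Prop. 5.13 locus) it is the `μ`-part of
the `2`-adic main conjecture. [cite: Kato2004Asterisque, Thm. 12.5 (3)(4) (p. 222), Thm. 13.4 (3) (p. 226), Thm. 17.4 (p. 273)] -/
theorem mainConjectureLowerDivisibilityAtTwoOrd_iff_katoMuPartAtTwo
    (h17 : ∀ [NeZero (W.conductorNorm ℤ)] (f : CuspForm (Gamma0 (W.conductorNorm ℤ)) 2),
      kato_divisibility_allPrimes W 2 (f := f))
    (hint : ∀ [NeZero (W.conductorNorm ℤ)] (f : CuspForm (Gamma0 (W.conductorNorm ℤ)) 2),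
      IsNewformOf W f → ∀ ϖ : ℚ, (ϖ : ℝ) * W.realPeriodRat = plusPeriod f →
        ∃ L₀ : IwasawaAlgebra 2, iwasawaToPowerSeries 2 L₀ =
          PowerSeries.C (ϖ : ℚ_[2]) * padicLFunction f (unitRoot W 2 : ℚ_[2])) :
    MainConjectureLowerDivisibilityAtTwoOrd W ↔ KatoMuPartAtTwo W :=
  ⟨katoMuPartAtTwo_of_mainConjectureLowerDivisibilityAtTwoOrd W h17,
    mainConjectureLowerDivisibilityAtTwoOrd_of_katoMuPartAtTwo W h17 hint⟩

end Summit.BirchSwinnertonDyer.Rank1Residual.X5.O1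

end
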